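import Summits.QuantumFields.BalabanUV.T4Continuum.Support.MinimalActionThm1Type
import Summits.QuantumFields.BalabanUV.T4Continuum.Support.MinimalActionClassSix
import HarnessLib

/-!
# T⁴ programme, node NE3 (η-rate of the minimisers) — THE ACTION SANDWICH, final assembly, part 4c:
# ROUTE (A) OVER A CLASS FAMILY THAT CONTAINS ITS TWO COMPETITORS — B11's CLASS (6) AS PRINTED INCLUDED

NE3 prover lineage P1, gen 18 (cell `pub-balaban`, unit `b2b-balaban-t4-ne3-p1`, row NE3 OWNER).  Answers the crew's finding
`MinimalActionClassSixNoBall.not_forall_sfClass_subset_classSix` (leaf-09 g2 ∕ leaf-04 g2, p215102 ∕ p215260): the binder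
`hsub : ∀ j, sfClass d L N ε j ⊆ 𝒞 j` of part 4b's END `MinimalActionThm1Type.actionRate_thm1Type_class` is UNSATISFIABLE at
B11's literal class (6) (`MinimalActionClassSix.ClassSix`, with the lattice-current condition (1.9)) for every `ε > 0`.  The
sandwich never needed a whole small-field BALL inside `𝒞`: it needs exactly its TWO COMPETITORS there — the rescaled one-step
average of a regular minimiser (A-H4) and the regular refinement produced by the crew's `ApproxRefine` (A-H2).  This file re-cuts
the END along that line.

CONTENT (0 def, 0 sorry): §1 `smoothRefine_of_mem` (the refinement shape passes from `sfClass ε′` to ANY `𝒞` containing every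
`RegularSup b′ c′` configuration); §2 `actionRate_of_exists_approx_mem` ∕ `…_mem_linear` (part 4-agnostic's ENDs with `hsub`
replaced by the two memberships (M1) `hRef : RegularSup B C (j+1) U → U ∈ 𝒞 (j+1)` and (M2) `h4 : rescale L (bavg L U) ∈ 𝒞 k` for
regular minimisers `U` of run `k+1`); §3 `lin_radius_le` and **`actionRate_thm1Type_mem`** — THE END OF ROUTE (A) OVER ANY CLASS
FAMILY `𝒞`: (H∃) over `𝒞` + `0 ≤ b, c ≤ t` + thresholds (i)–(iii) of part 4b + the two radius thresholds `(K_b + 8K_mL^{d+2})·t ≤ B ≤ 1`,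
`(K_c + 36K_mL^{d+2})·t ≤ C ≤ 1` + (M1) at `(B, C)` + (M2) ⇒ `ActionRate (minActReadings d 𝒞 L N dom loc) (wallConstNA(d,L)(gradConst d 1
+ 1)/L²) (L⁻²)` (no class radius `ε` at all: the auxiliary ball is chosen internally); §4 **`actionRate_classSix_thm1Type`** — the
case `𝒞 = ClassSix d L N ε₀` (B11's (6) AS PRINTED, everywhere-small-field case): (M1) is DISCHARGED by the crew's k-uniform
`MinimalActionClassSix.mem_classSix_of_regularSup` (`B ≤ 1/4`, `B < ε₀`, `2(d−1)C < ε₀`), (M2) remains — it is B8 Prop. 3 ∕ B7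
(128)–(129) TYPE («averaging preserves the regular spaces»; the skeleton's located risk (r3)), a typed HYPOTHESIS over the tree's
objects, asserted nowhere.

HONEST FRAMING.  **NE3 is NOT proved**: (H∃) ([Balaban1985Variational] Thm 1 (8)+(9)+(10) p. 279 TYPE) and, over class (6), the
transport (M2) (B8 Prop. 3 TYPE) are HYPOTHESES; the LOCAL half is untouched here; nothing printed is a hypothesis of a theorem (the
shapes are ours, over the tree's objects); no conditional of the cell (`BetaPertH`, (B), (B^μ), G-an2-4); no `def`, no `sorry`,
axioms ⊆ {propext, Classical.choice, Quot.sound}.  Finite T⁴ rung (B)+1 — NOT infinite volume, NOT a mass gap, NOT the Clay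
problem, NOT summit progress.  PLACEMENT: `Summits/QuantumFields/BalabanUV/`.  HONEST DEPENDENCY (cell page 1): continuum YM on T⁴ ⇐
BetaPertH ∧ nine spine estimates (0/9 proved); BetaPertH ⇐ (D1) ∧ (D4) ∧ CAP+tail; G-an2-4 gates asym, D1 and NE2/3/4.
-/

set_option autoImplicit false

open scoped BigOperators Matrix Matrix.Norms.L2Operator Topology
open NormedSpace Filter

namespace Summit.QuantumFields.BalabanUV.T4Continuum.MinimalActionMemClass

open Literature.MathematicalPhysics.QuantumFieldTheory.Balaban1983to89
open B7Prop1Explicit B7Prop2Explicit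
open T4AveragingDeficitWall hiding Site Plane Plaq Bond
open T4AveragingDeficitNonAbelian (wallConstNA wallConstNA_nonneg)
open T4EtaRateMin (Readings ActionRate)
open MinimalActionSandwich MinimalActionRate MinimalActionRefine SmoothRefineOfApprox ChainEndFix
open MinimalActionRateExists MinimalActionRegime MinimalActionFinalApprox MinimalActionMismatchSmall
open MinimalActionClassAgnostic (mem_sfClass_of_regularSup)
open MinimalActionThm1Type (actionRate_mono radii_le_one)
open MinimalActionClassSix (ClassSix mem_classSix_of_regularSup)
open SkeletonPrecompGrad (gradRem gradRem_nonneg)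
open ApproxRefineRegime (sideConds_of_small fillRadius_le_of_small gradRadius_le_of_small)
open ApproxRefineEnd (approxRefine_sfClass)

noncomputable section

variable {d : ℕ} {n : Type*} [Fintype n] [DecidableEq n] [Nonempty n]

/-! ## §1 The refinement shape over a class containing every regular configuration -/

omit [Nonempty n] in
/-- `SmoothRefine` passes from the small-field class `sfClass ε′` (`b ≤ ε′`) to ANY class family `𝒞` that contains every
configuration of sup-form regularity `(b′, c′)` at the refined level: the input `U ∈ 𝒞 j` with `RegularSup b c j` lies in
`sfClass ε′ j`, and the output is placed in `𝒞 (j+1)` by the membership hypothesis. [folklore] -/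
theorem smoothRefine_of_mem {𝒞 : ℕ → Set (Site d → Fin d → (Matrix n n ℂ)ˣ)} {L N : ℕ} {b c b' c' ε' : ℝ} (hb : b ≤ ε')
    (hRef : ∀ (j : ℕ) (U : Site d → Fin d → (Matrix n n ℂ)ˣ), RegularSup d L N b' c' (j + 1) U → U ∈ 𝒞 (j + 1))
    (hR : SmoothRefine d (sfClass (n := n) d L N ε') L N b c b' c') : SmoothRefine d 𝒞 L N b c b' c' := by
  intro j U _ hreg
  obtain ⟨Ut, _, havg, hreg'⟩ := hR j U (mem_sfClass_of_regularSup hb hreg) hreg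
  exact ⟨Ut, hRef j Ut hreg', havg, hreg'⟩

/-! ## §2 The ENDs over a class containing the two competitors -/

/-- **ROUTE (A)'s ACTION HALF OVER ANY CLASS FAMILY CONTAINING THE SANDWICH's TWO COMPETITORS.**  As
`MinimalActionClassAgnostic.actionRate_of_exists_approx_class`, with the ball inclusion `sfClass ε′ ⊆ 𝒞` replaced by:
(M1) every configuration of sup-form regularity `(b₁ + 8mL³/g, c₁ + 36mL³/g)` at a refined level lies in `𝒞` there, and
(M2) the rescaled one-step average of every `(b, c)`-regular run-`(k+1)` minimiser lies in `𝒞 k`.  Conclusion unchanged: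
`ActionRate (minActReadings d 𝒞 L N dom loc) (wallConstNA(d,L)(gradConst d (max c c′) + (max b b′)³)/L²) (L⁻²)`. [folklore] -/
theorem actionRate_of_exists_approx_mem {𝒞 : ℕ → Set (Site d → Fin d → (Matrix n n ℂ)ˣ)} {L N : ℕ} (hL : 1 ≤ L)
    (hN : 1 ≤ N) {b c b₁ c₁ m ε' : ℝ} (hb : 0 ≤ b) (hb₁ : 0 ≤ b₁) (hm : 0 ≤ m)
    (hRef : ∀ (j : ℕ) (U : Site d → Fin d → (Matrix n n ℂ)ˣ),
      RegularSup d L N (b₁ + 8 * m * (L : ℝ) ^ 3 / gap d L) (c₁ + 36 * m * (L : ℝ) ^ 3 / gap d L) (j + 1) U → U ∈ 𝒞 (j + 1))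
    (hRb : 2 ^ 15 * ((d : ℝ) + 1) ^ 2 * ((d : ℝ) + 4) ^ 2 * (L : ℝ) ^ 2 * b ≤ 1)
    (hRr : 2 ^ 10 * ((d : ℝ) + 1) * ((d : ℝ) + 4) * (L : ℝ) ^ 2 * (b₁ + 8 * m * (L : ℝ) ^ 3 / gap d L) ≤ gap d L)
    (hRε : 2 * max b (b₁ + 8 * m * (L : ℝ) ^ 3 / gap d L) ≤ ε')
    {dom : Set (Site d → Fin d → (Matrix n n ℂ)ˣ)}
    (hmin : ∀ V ∈ dom, ∀ k : ℕ, ∃ U, IsMinimiser d 𝒞 L N k V U ∧ RegularSup d L N b c k U)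
    (h4 : ∀ V ∈ dom, ∀ (k : ℕ) (U : Site d → Fin d → (Matrix n n ℂ)ˣ),
      IsMinimiser d 𝒞 L N (k + 1) V U → RegularSup d L N b c (k + 1) U → rescale L (bavg L U) ∈ 𝒞 k)
    (hA : ApproxRefine d (sfClass (n := n) d L N ε') L N b c b₁ c₁ m)
    {X : Type*} (loc : ℕ → (Site d → Fin d → (Matrix n n ℂ)ˣ) → X → ℝ) :
    ActionRate (minActReadings d 𝒞 L N dom loc)
      (wallConstNA d L * (gradConst d (max c (c₁ + 36 * m * (L : ℝ) ^ 3 / gap d L))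
        + (max b (b₁ + 8 * m * (L : ℝ) ^ 3 / gap d L)) ^ 3) / (L : ℝ) ^ 2) (((L : ℝ) ^ 2)⁻¹) := by
  obtain ⟨hBs, -, hbs₁, hgap, hhalf, hε⟩ := sideConds_of_regime hL hb hb₁ hm hRb hRr hRε
  have hbε' : b ≤ ε' := by
    have h1 := le_max_left b (b₁ + 8 * m * (L : ℝ) ^ 3 / gap d L)
    have h2 : 0 ≤ max b (b₁ + 8 * m * (L : ℝ) ^ 3 / gap d L) := hb.trans h1
    linarith
  have hR : SmoothRefine d 𝒞 L N b c (b₁ + 8 * m * (L : ℝ) ^ 3 / gap d L) (c₁ + 36 * m * (L : ℝ) ^ 3 / gap d L) :=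
    smoothRefine_of_mem hbε' hRef (smoothRefine_of_approxRefine hL hb₁ hm hbs₁ hgap hhalf hε hA)
  exact actionRate_of_exists hL hN hb hBs hmin h4 hR loc

/-- The LINEAR-BOUNDS form of `actionRate_of_exists_approx_mem`. [folklore] -/
theorem actionRate_of_exists_approx_mem_linear (hd : 1 ≤ d) {𝒞 : ℕ → Set (Site d → Fin d → (Matrix n n ℂ)ˣ)}
    {L N : ℕ} (hL : 1 ≤ L) (hN : 1 ≤ N) {t K b c b₁ c₁ m ε' : ℝ} (ht : 0 ≤ t) (hK : 1 ≤ K) (hb : 0 ≤ b) (hb₁ : 0 ≤ b₁)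
    (hm : 0 ≤ m) (hbt : b ≤ t) (hb₁t : b₁ ≤ K * t) (hmt : m ≤ K * t)
    (hRef : ∀ (j : ℕ) (U : Site d → Fin d → (Matrix n n ℂ)ˣ),
      RegularSup d L N (b₁ + 8 * m * (L : ℝ) ^ 3 / gap d L) (c₁ + 36 * m * (L : ℝ) ^ 3 / gap d L) (j + 1) U → U ∈ 𝒞 (j + 1))
    (h1 : 2 ^ 15 * ((d : ℝ) + 1) ^ 2 * ((d : ℝ) + 4) ^ 2 * (L : ℝ) ^ 2 * t ≤ 1)
    (h2 : 2 ^ 14 * ((d : ℝ) + 1) * ((d : ℝ) + 4) * (L : ℝ) ^ (2 * d + 3) * K * t ≤ 1)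
    (hεt : 18 * K * (L : ℝ) ^ (d + 2) * t ≤ ε')
    {dom : Set (Site d → Fin d → (Matrix n n ℂ)ˣ)}
    (hmin : ∀ V ∈ dom, ∀ k : ℕ, ∃ U, IsMinimiser d 𝒞 L N k V U ∧ RegularSup d L N b c k U)
    (h4 : ∀ V ∈ dom, ∀ (k : ℕ) (U : Site d → Fin d → (Matrix n n ℂ)ˣ),
      IsMinimiser d 𝒞 L N (k + 1) V U → RegularSup d L N b c (k + 1) U → rescale L (bavg L U) ∈ 𝒞 k)
    (hA : ApproxRefine d (sfClass (n := n) d L N ε') L N b c b₁ c₁ m)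
    {X : Type*} (loc : ℕ → (Site d → Fin d → (Matrix n n ℂ)ˣ) → X → ℝ) :
    ActionRate (minActReadings d 𝒞 L N dom loc)
      (wallConstNA d L * (gradConst d (max c (c₁ + 36 * m * (L : ℝ) ^ 3 / gap d L))
        + (max b (b₁ + 8 * m * (L : ℝ) ^ 3 / gap d L)) ^ 3) / (L : ℝ) ^ 2) (((L : ℝ) ^ 2)⁻¹) := by
  obtain ⟨hRb, hRr, hRε⟩ := regime_of_linear_bounds hd hL ht hK hbt hb₁t hmt h1 h2
  exact actionRate_of_exists_approx_mem hL hN hb hb₁ hm hRef hRb hRr (hRε.trans hεt) hmin h4 hA loc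

/-! ## §3 The END of route (A) over a class containing the competitors, on B11 Theorem 1 TYPE -/

omit [Fintype n] [DecidableEq n] [Nonempty n] in
/-- Arithmetic: `R ≤ K_R·t`, `M ≤ K_M·t`, `(K_R + a·K_M·P)·t ≤ X` (`a, P ≥ 0`) give `R + a·M·P ≤ X`. [folklore] -/
theorem lin_radius_le {t R M KR KM P a X : ℝ} (hP : 0 ≤ P) (ha : 0 ≤ a) (hR : R ≤ KR * t) (hM : M ≤ KM * t)
    (h : (KR + a * KM * P) * t ≤ X) : R + a * M * P ≤ X := by
  have hMP : M * P ≤ KM * t * P := mul_le_mul_of_nonneg_right hM hP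
  have h2 : a * (M * P) ≤ a * (KM * t * P) := mul_le_mul_of_nonneg_left hMP ha
  have e1 : R + a * M * P = R + a * (M * P) := by ring
  have e2 : (KR + a * KM * P) * t = KR * t + a * (KM * t * P) := by ring
  linarith

/-- **NE3, ROUTE (A) — THE η-RATE OF THE MINIMAL ACTIONS FROM B11 THEOREM 1 TYPE, OVER ANY CLASS FAMILY CONTAINING THE
SANDWICH's TWO COMPETITORS** (no small-field ball required — B11's class (6) AS PRINTED qualifies via §4).  Let `d ≥ 1`,
`L, N ≥ 1`, `0 ≤ b ≤ t`, `0 ≤ c ≤ t`, thresholds (i)–(iii) of part 4b, and two radii `B, C ≤ 1` with `(K_b + 8K_mL^{d+2})·t ≤ B`,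
`(K_c + 36K_mL^{d+2})·t ≤ C` (the displayed polynomials; at `B = C = 1` these are (iv), (v) of part 4b).  IF (H∃) every datum
`V ∈ dom` has at every level a minimiser over `𝒞` with sup-form regularity `(b, c)` ([Balaban1985Variational] Thm 1 TYPE — a
hypothesis), (M2) the rescaled one-step average of every such run-`(k+1)` minimiser lies in `𝒞 k` (over class (6): B8 Prop. 3
TYPE — a hypothesis; over `sfClass`: part 1's theorem), and (M1) `𝒞 (j+1)` contains every configuration of sup-form regularity
`(B, C)`, THEN `ActionRate (minActReadings d 𝒞 L N dom loc) (wallConstNA(d,L)·(gradConst d 1 + 1)/L²) (L⁻²)`.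
NE3 is NOT proved by this. [folklore] -/
theorem actionRate_thm1Type_mem (hd : 1 ≤ d) {𝒞 : ℕ → Set (Site d → Fin d → (Matrix n n ℂ)ˣ)} {L N : ℕ}
    (hL : 1 ≤ L) (hN : 1 ≤ N) {b c t B C : ℝ} (hb : 0 ≤ b) (hc : 0 ≤ c) (hbt : b ≤ t) (hct : c ≤ t)
    (hBle : B ≤ 1) (hCle : C ≤ 1)
    (hT1 : (160 * d + 168 * (d : ℝ) ^ 2 + 2 * (32 * d + (24 * d * (2 * (d : ℝ) + gradRem d) + 14336 * (d : ℝ) ^ 2 * ((d : ℝ) + 1) ^ 2)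
            + 12 * (2 * (d : ℝ) + gradRem d))
        + 512 * ((d : ℝ) + 1) * ((d : ℝ) + 4) * (L : ℝ) ^ 2
          * (32 * d + 48 * d * (L : ℝ) ^ 2 * (2 * (d : ℝ) + gradRem d)
            + 8192 * (d : ℝ) ^ 2 * (2 * (d : ℝ) + 1) ^ 2 * (L : ℝ) ^ 2)) * t ≤ 1)
    (hT2 : 2 ^ 15 * ((d : ℝ) + 1) ^ 2 * ((d : ℝ) + 4) ^ 2 * (L : ℝ) ^ 2 * t ≤ 1)
    (hT3 : 2 ^ 14 * ((d : ℝ) + 1) * ((d : ℝ) + 4) * (L : ℝ) ^ (2 * d + 3)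
          * ((32 * d + 48 * d * (L : ℝ) ^ 2 * (2 * (d : ℝ) + gradRem d)
              + 8192 * (d : ℝ) ^ 2 * (2 * (d : ℝ) + 1) ^ 2 * (L : ℝ) ^ 2)
            + (3 * (1280 * d * ((d : ℝ) + 1) ^ 2 * ((d : ℝ) + 4) ^ 2 * (L : ℝ) ^ 2
            * (32 * d + 48 * d * (L : ℝ) ^ 2 * (2 * (d : ℝ) + gradRem d)
              + 8192 * (d : ℝ) ^ 2 * (2 * (d : ℝ) + 1) ^ 2 * (L : ℝ) ^ 2) ^ 2
          + d * ((d : ℝ) + 1) * ((L : ℝ) ^ 3 * (256 * (d : ℝ) ^ 2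
              * (32 * d + (24 * d * (2 * (d : ℝ) + gradRem d) + 14336 * (d : ℝ) ^ 2 * ((d : ℝ) + 1) ^ 2)
                + 12 * (2 * (d : ℝ) + gradRem d))
            + 4 * (24 * d * (2 * (d : ℝ) + gradRem d) + 14336 * (d : ℝ) ^ 2 * ((d : ℝ) + 1) ^ 2)
            + 24 * (2 * (d : ℝ) + gradRem d)))
          + ((d : ℝ) - 1) ^ 2 * (37 * ((d : ℝ) - 1) + 5)))) * t ≤ 1)
    (hB : ((32 * d + 48 * d * (L : ℝ) ^ 2 * (2 * (d : ℝ) + gradRem d)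
              + 8192 * (d : ℝ) ^ 2 * (2 * (d : ℝ) + 1) ^ 2 * (L : ℝ) ^ 2)
            + 8 * (3 * (1280 * d * ((d : ℝ) + 1) ^ 2 * ((d : ℝ) + 4) ^ 2 * (L : ℝ) ^ 2
            * (32 * d + 48 * d * (L : ℝ) ^ 2 * (2 * (d : ℝ) + gradRem d)
              + 8192 * (d : ℝ) ^ 2 * (2 * (d : ℝ) + 1) ^ 2 * (L : ℝ) ^ 2) ^ 2
          + d * ((d : ℝ) + 1) * ((L : ℝ) ^ 3 * (256 * (d : ℝ) ^ 2
              * (32 * d + (24 * d * (2 * (d : ℝ) + gradRem d) + 14336 * (d : ℝ) ^ 2 * ((d : ℝ) + 1) ^ 2)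
                + 12 * (2 * (d : ℝ) + gradRem d))
            + 4 * (24 * d * (2 * (d : ℝ) + gradRem d) + 14336 * (d : ℝ) ^ 2 * ((d : ℝ) + 1) ^ 2)
            + 24 * (2 * (d : ℝ) + gradRem d)))
          + ((d : ℝ) - 1) ^ 2 * (37 * ((d : ℝ) - 1) + 5))) * (L : ℝ) ^ (d + 2)) * t ≤ B)
    (hC : (((L : ℝ) ^ 3 * (256 * (d : ℝ) ^ 2
              * (32 * d + (24 * d * (2 * (d : ℝ) + gradRem d) + 14336 * (d : ℝ) ^ 2 * ((d : ℝ) + 1) ^ 2)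
                + 12 * (2 * (d : ℝ) + gradRem d))
            + 4 * (24 * d * (2 * (d : ℝ) + gradRem d) + 14336 * (d : ℝ) ^ 2 * ((d : ℝ) + 1) ^ 2)
            + 24 * (2 * (d : ℝ) + gradRem d)))
            + 36 * (3 * (1280 * d * ((d : ℝ) + 1) ^ 2 * ((d : ℝ) + 4) ^ 2 * (L : ℝ) ^ 2
            * (32 * d + 48 * d * (L : ℝ) ^ 2 * (2 * (d : ℝ) + gradRem d)
              + 8192 * (d : ℝ) ^ 2 * (2 * (d : ℝ) + 1) ^ 2 * (L : ℝ) ^ 2) ^ 2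
          + d * ((d : ℝ) + 1) * ((L : ℝ) ^ 3 * (256 * (d : ℝ) ^ 2
              * (32 * d + (24 * d * (2 * (d : ℝ) + gradRem d) + 14336 * (d : ℝ) ^ 2 * ((d : ℝ) + 1) ^ 2)
                + 12 * (2 * (d : ℝ) + gradRem d))
            + 4 * (24 * d * (2 * (d : ℝ) + gradRem d) + 14336 * (d : ℝ) ^ 2 * ((d : ℝ) + 1) ^ 2)
            + 24 * (2 * (d : ℝ) + gradRem d)))
          + ((d : ℝ) - 1) ^ 2 * (37 * ((d : ℝ) - 1) + 5))) * (L : ℝ) ^ (d + 2)) * t ≤ C)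
    {dom : Set (Site d → Fin d → (Matrix n n ℂ)ˣ)}
    (hmin : ∀ V ∈ dom, ∀ k : ℕ, ∃ U, IsMinimiser d 𝒞 L N k V U ∧ RegularSup d L N b c k U)
    (h4 : ∀ V ∈ dom, ∀ (k : ℕ) (U : Site d → Fin d → (Matrix n n ℂ)ˣ),
      IsMinimiser d 𝒞 L N (k + 1) V U → RegularSup d L N b c (k + 1) U → rescale L (bavg L U) ∈ 𝒞 k)
    (hRef : ∀ (j : ℕ) (U : Site d → Fin d → (Matrix n n ℂ)ˣ), RegularSup d L N B C (j + 1) U → U ∈ 𝒞 (j + 1))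
    {X : Type*} (loc : ℕ → (Site d → Fin d → (Matrix n n ℂ)ˣ) → X → ℝ) :
    ActionRate (minActReadings d 𝒞 L N dom loc)
      (wallConstNA d L * (gradConst d 1 + 1) / (L : ℝ) ^ 2) (((L : ℝ) ^ 2)⁻¹) := by
  have hL1 : (1 : ℝ) ≤ L := by exact_mod_cast hL
  have hL0 : (0 : ℝ) < L := by linarith
  have hd1 : (1 : ℝ) ≤ d := by exact_mod_cast hd
  have hd0 : (0 : ℝ) ≤ d := by positivity
  have ht0 : 0 ≤ t := hb.trans hbt
  have hΓ := gradRem_nonneg hd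
  have hLd2 : 0 ≤ (L : ℝ) ^ (d + 2) := by positivity
  -- `t ≤ 1` from (ii)
  have ht1 : t ≤ 1 := by
    have h1' : (1 : ℝ) ≤ ((d : ℝ) + 1) ^ 2 := one_le_pow₀ (by linarith)
    have h4' : (1 : ℝ) ≤ ((d : ℝ) + 4) ^ 2 := one_le_pow₀ (by linarith)
    have hL2 : (1 : ℝ) ≤ (L : ℝ) ^ 2 := one_le_pow₀ hL1
    have hc2 : (1 : ℝ) ≤ 2 ^ 15 * ((d : ℝ) + 1) ^ 2 * ((d : ℝ) + 4) ^ 2 * (L : ℝ) ^ 2 :=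
      one_le_mul_of_one_le_of_one_le (one_le_mul_of_one_le_of_one_le
        (one_le_mul_of_one_le_of_one_le (by norm_num) h1') h4') hL2
    have := mul_le_mul_of_nonneg_right hc2 ht0
    linarith
  -- the crew's R1 END and the envelopes (all stated with the displayed closed expressions)
  obtain ⟨h16, hdb, hquarter, hhalf, h512⟩ := sideConds_of_small hd hL hb hc hbt hct hT1
  have hA := approxRefine_sfClass (n := n) hd L N hL
    (ε := 18 * ((32 * d + 48 * d * (L : ℝ) ^ 2 * (2 * (d : ℝ) + gradRem d)
              + 8192 * (d : ℝ) ^ 2 * (2 * (d : ℝ) + 1) ^ 2 * (L : ℝ) ^ 2)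
      + (3 * (1280 * d * ((d : ℝ) + 1) ^ 2 * ((d : ℝ) + 4) ^ 2 * (L : ℝ) ^ 2
            * (32 * d + 48 * d * (L : ℝ) ^ 2 * (2 * (d : ℝ) + gradRem d)
              + 8192 * (d : ℝ) ^ 2 * (2 * (d : ℝ) + 1) ^ 2 * (L : ℝ) ^ 2) ^ 2
          + d * ((d : ℝ) + 1) * ((L : ℝ) ^ 3 * (256 * (d : ℝ) ^ 2
              * (32 * d + (24 * d * (2 * (d : ℝ) + gradRem d) + 14336 * (d : ℝ) ^ 2 * ((d : ℝ) + 1) ^ 2)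
                + 12 * (2 * (d : ℝ) + gradRem d))
            + 4 * (24 * d * (2 * (d : ℝ) + gradRem d) + 14336 * (d : ℝ) ^ 2 * ((d : ℝ) + 1) ^ 2)
            + 24 * (2 * (d : ℝ) + gradRem d)))
          + ((d : ℝ) - 1) ^ 2 * (37 * ((d : ℝ) - 1) + 5)))) * (L : ℝ) ^ (d + 2) * t) hb hc h16 hdb hquarter hhalf h512
  have hB1 := fillRadius_le_of_small hd L hb hbt hct ht1
  have hB0 := fillRadius_nonneg hd L hb hc
  have hC1 := gradRadius_le_of_small hd L hb hc hbt hct ht1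
  have hM1 := mismatch_le_of_small hd L hb hc hbt hct ht1
  have hM0 := mismatch_nonneg hd L hb hc
  have hKB0 : 0 ≤ (32 * d + 48 * d * (L : ℝ) ^ 2 * (2 * (d : ℝ) + gradRem d)
              + 8192 * (d : ℝ) ^ 2 * (2 * (d : ℝ) + 1) ^ 2 * (L : ℝ) ^ 2) := by positivity
  have hKB1 : 1 ≤ (32 * d + 48 * d * (L : ℝ) ^ 2 * (2 * (d : ℝ) + gradRem d)
              + 8192 * (d : ℝ) ^ 2 * (2 * (d : ℝ) + 1) ^ 2 * (L : ℝ) ^ 2) := by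
    have h48 : 0 ≤ 48 * d * (L : ℝ) ^ 2 * (2 * (d : ℝ) + gradRem d) := by positivity
    have h8192 : 0 ≤ 8192 * (d : ℝ) ^ 2 * (2 * (d : ℝ) + 1) ^ 2 * (L : ℝ) ^ 2 := by positivity
    linarith
  have hKM0 : 0 ≤ (3 * (1280 * d * ((d : ℝ) + 1) ^ 2 * ((d : ℝ) + 4) ^ 2 * (L : ℝ) ^ 2
            * (32 * d + 48 * d * (L : ℝ) ^ 2 * (2 * (d : ℝ) + gradRem d)
              + 8192 * (d : ℝ) ^ 2 * (2 * (d : ℝ) + 1) ^ 2 * (L : ℝ) ^ 2) ^ 2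
          + d * ((d : ℝ) + 1) * ((L : ℝ) ^ 3 * (256 * (d : ℝ) ^ 2
              * (32 * d + (24 * d * (2 * (d : ℝ) + gradRem d) + 14336 * (d : ℝ) ^ 2 * ((d : ℝ) + 1) ^ 2)
                + 12 * (2 * (d : ℝ) + gradRem d))
            + 4 * (24 * d * (2 * (d : ℝ) + gradRem d) + 14336 * (d : ℝ) ^ 2 * ((d : ℝ) + 1) ^ 2)
            + 24 * (2 * (d : ℝ) + gradRem d)))
          + ((d : ℝ) - 1) ^ 2 * (37 * ((d : ℝ) - 1) + 5))) := by
    have h37 : 0 ≤ 37 * ((d : ℝ) - 1) + 5 := by linarith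
    positivity
  -- linear bounds with the common constant `K_b + K_m ≥ 1` (structural steps only — the expressions are large)
  have hKsum := le_add_of_le_of_nonneg hKB1 hKM0
  have hB1' := hB1.trans (mul_le_mul_of_nonneg_right (le_add_of_nonneg_right hKM0) ht0)
  have hM1' := hM1.trans (mul_le_mul_of_nonneg_right (le_add_of_nonneg_left hKB0) ht0)
  -- the explicit radii of the refined competitor are below `(B, C)`
  have hg : (L : ℝ) ^ 3 / gap d L = (L : ℝ) ^ (d + 2) := by
    rw [gap_eq hL hd, div_div_eq_mul_div, pow_add,
      show (L : ℝ) ^ 3 * (L : ℝ) ^ d = (L : ℝ) ^ d * (L : ℝ) ^ 2 * L by ring, mul_div_cancel_right₀ _ hL0.ne']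
  have e8 : ∀ x : ℝ, 8 * x * (L : ℝ) ^ 3 / gap d L = 8 * x * (L : ℝ) ^ (d + 2) := fun x => by
    rw [mul_div_assoc, hg]
  have e36 : ∀ x : ℝ, 36 * x * (L : ℝ) ^ 3 / gap d L = 36 * x * (L : ℝ) ^ (d + 2) := fun x => by
    rw [mul_div_assoc, hg]
  have hrate := actionRate_of_exists_approx_mem_linear hd hL hN ht0 hKsum hb hB0 hM0 hbt hB1' hM1'
    (fun j U hU => hRef j U (hU.mono
      (by rw [e8]; exact lin_radius_le hLd2 (by norm_num) hB1 hM1 hB)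
      (by rw [e36]; exact lin_radius_le hLd2 (by norm_num) hC1 hM1 hC)))
    hT2 hT3 le_rfl hmin h4 hA loc
  -- normalise the constant: both `max`es are `≤ 1`
  refine actionRate_mono hrate ?_ (by positivity)
  obtain ⟨hr1, hr2⟩ := radii_le_one hLd2 hB1 hC1 hM1 (hB.trans hBle) (hC.trans hCle)
  rw [e8, e36]
  have hmax1 := max_le (hbt.trans ht1) hr1
  have hmax2 := max_le (hct.trans ht1) hr2
  have hgc := gradConst_mono (d := d) (le_max_of_le_left hc) hmax2
  have hcube := pow_le_one₀ (n := 3) (le_max_of_le_left hb) hmax1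
  have hW := wallConstNA_nonneg (d := d) L
  have hL2 : (0 : ℝ) < (L : ℝ) ^ 2 := by positivity
  rw [div_le_div_iff_of_pos_right hL2]
  exact mul_le_mul_of_nonneg_left (add_le_add hgc hcube) hW

/-! ## §4 B11's class (6) as printed -/

/-- **ROUTE (A) OVER B11's CLASS (6) AS PRINTED** (`𝒞 = ClassSix d L N ε₀`: `U(N)`-valued, periodic, plaquette condition (1.7)
AND lattice-current condition (1.9) at all levels — `MinimalActionClassSix`).  (M1) is DISCHARGED k-uniformly by the crew's
`mem_classSix_of_regularSup` for radii `0 ≤ B ≤ 1/4`, `B < ε₀`, `2(d−1)C < ε₀`; what remains typed: (H∃) over class (6)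
([Balaban1985Variational] Thm 1 p. 279 TYPE, now LITERALLY Bałaban's variational problem in the everywhere-small-field case,
modulo the sup-norm dictionary of sub-row S3) and (M2) = «the one-step average of a regular minimiser in (6) at level `k+1`,
read on the next lattice, lies in (6) at level `k`» ([Balaban1985RegularSpaces] Prop. 3 ∕ [Balaban1985Averaging] (128)–(129)
TYPE — a HYPOTHESIS over the tree's objects, asserted nowhere).  NE3 is NOT proved by this. [folklore] -/
theorem actionRate_classSix_thm1Type (hd : 1 ≤ d) {L N : ℕ} (hL : 1 ≤ L) (hN : 1 ≤ N) {b c t B C ε₀ : ℝ}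
    (hb : 0 ≤ b) (hc : 0 ≤ c) (hbt : b ≤ t) (hct : c ≤ t) (hB0 : 0 ≤ B) (hB4 : B ≤ 1 / 4) (hBε : B < ε₀)
    (hCε : 2 * ((d : ℝ) - 1) * C < ε₀) (hCle : C ≤ 1)
    (hT1 : (160 * d + 168 * (d : ℝ) ^ 2 + 2 * (32 * d + (24 * d * (2 * (d : ℝ) + gradRem d) + 14336 * (d : ℝ) ^ 2 * ((d : ℝ) + 1) ^ 2)
            + 12 * (2 * (d : ℝ) + gradRem d))
        + 512 * ((d : ℝ) + 1) * ((d : ℝ) + 4) * (L : ℝ) ^ 2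
          * (32 * d + 48 * d * (L : ℝ) ^ 2 * (2 * (d : ℝ) + gradRem d)
            + 8192 * (d : ℝ) ^ 2 * (2 * (d : ℝ) + 1) ^ 2 * (L : ℝ) ^ 2)) * t ≤ 1)
    (hT2 : 2 ^ 15 * ((d : ℝ) + 1) ^ 2 * ((d : ℝ) + 4) ^ 2 * (L : ℝ) ^ 2 * t ≤ 1)
    (hT3 : 2 ^ 14 * ((d : ℝ) + 1) * ((d : ℝ) + 4) * (L : ℝ) ^ (2 * d + 3)
          * ((32 * d + 48 * d * (L : ℝ) ^ 2 * (2 * (d : ℝ) + gradRem d)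
              + 8192 * (d : ℝ) ^ 2 * (2 * (d : ℝ) + 1) ^ 2 * (L : ℝ) ^ 2)
            + (3 * (1280 * d * ((d : ℝ) + 1) ^ 2 * ((d : ℝ) + 4) ^ 2 * (L : ℝ) ^ 2
            * (32 * d + 48 * d * (L : ℝ) ^ 2 * (2 * (d : ℝ) + gradRem d)
              + 8192 * (d : ℝ) ^ 2 * (2 * (d : ℝ) + 1) ^ 2 * (L : ℝ) ^ 2) ^ 2
          + d * ((d : ℝ) + 1) * ((L : ℝ) ^ 3 * (256 * (d : ℝ) ^ 2
              * (32 * d + (24 * d * (2 * (d : ℝ) + gradRem d) + 14336 * (d : ℝ) ^ 2 * ((d : ℝ) + 1) ^ 2)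
                + 12 * (2 * (d : ℝ) + gradRem d))
            + 4 * (24 * d * (2 * (d : ℝ) + gradRem d) + 14336 * (d : ℝ) ^ 2 * ((d : ℝ) + 1) ^ 2)
            + 24 * (2 * (d : ℝ) + gradRem d)))
          + ((d : ℝ) - 1) ^ 2 * (37 * ((d : ℝ) - 1) + 5)))) * t ≤ 1)
    (hB : ((32 * d + 48 * d * (L : ℝ) ^ 2 * (2 * (d : ℝ) + gradRem d)
              + 8192 * (d : ℝ) ^ 2 * (2 * (d : ℝ) + 1) ^ 2 * (L : ℝ) ^ 2)
            + 8 * (3 * (1280 * d * ((d : ℝ) + 1) ^ 2 * ((d : ℝ) + 4) ^ 2 * (L : ℝ) ^ 2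
            * (32 * d + 48 * d * (L : ℝ) ^ 2 * (2 * (d : ℝ) + gradRem d)
              + 8192 * (d : ℝ) ^ 2 * (2 * (d : ℝ) + 1) ^ 2 * (L : ℝ) ^ 2) ^ 2
          + d * ((d : ℝ) + 1) * ((L : ℝ) ^ 3 * (256 * (d : ℝ) ^ 2
              * (32 * d + (24 * d * (2 * (d : ℝ) + gradRem d) + 14336 * (d : ℝ) ^ 2 * ((d : ℝ) + 1) ^ 2)
                + 12 * (2 * (d : ℝ) + gradRem d))
            + 4 * (24 * d * (2 * (d : ℝ) + gradRem d) + 14336 * (d : ℝ) ^ 2 * ((d : ℝ) + 1) ^ 2)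
            + 24 * (2 * (d : ℝ) + gradRem d)))
          + ((d : ℝ) - 1) ^ 2 * (37 * ((d : ℝ) - 1) + 5))) * (L : ℝ) ^ (d + 2)) * t ≤ B)
    (hC : (((L : ℝ) ^ 3 * (256 * (d : ℝ) ^ 2
              * (32 * d + (24 * d * (2 * (d : ℝ) + gradRem d) + 14336 * (d : ℝ) ^ 2 * ((d : ℝ) + 1) ^ 2)
                + 12 * (2 * (d : ℝ) + gradRem d))
            + 4 * (24 * d * (2 * (d : ℝ) + gradRem d) + 14336 * (d : ℝ) ^ 2 * ((d : ℝ) + 1) ^ 2)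
            + 24 * (2 * (d : ℝ) + gradRem d)))
            + 36 * (3 * (1280 * d * ((d : ℝ) + 1) ^ 2 * ((d : ℝ) + 4) ^ 2 * (L : ℝ) ^ 2
            * (32 * d + 48 * d * (L : ℝ) ^ 2 * (2 * (d : ℝ) + gradRem d)
              + 8192 * (d : ℝ) ^ 2 * (2 * (d : ℝ) + 1) ^ 2 * (L : ℝ) ^ 2) ^ 2
          + d * ((d : ℝ) + 1) * ((L : ℝ) ^ 3 * (256 * (d : ℝ) ^ 2
              * (32 * d + (24 * d * (2 * (d : ℝ) + gradRem d) + 14336 * (d : ℝ) ^ 2 * ((d : ℝ) + 1) ^ 2)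
                + 12 * (2 * (d : ℝ) + gradRem d))
            + 4 * (24 * d * (2 * (d : ℝ) + gradRem d) + 14336 * (d : ℝ) ^ 2 * ((d : ℝ) + 1) ^ 2)
            + 24 * (2 * (d : ℝ) + gradRem d)))
          + ((d : ℝ) - 1) ^ 2 * (37 * ((d : ℝ) - 1) + 5))) * (L : ℝ) ^ (d + 2)) * t ≤ C)
    {dom : Set (Site d → Fin d → (Matrix n n ℂ)ˣ)}
    (hmin : ∀ V ∈ dom, ∀ k : ℕ, ∃ U, IsMinimiser d (ClassSix d L N ε₀) L N k V U ∧ RegularSup d L N b c k U)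
    (h4 : ∀ V ∈ dom, ∀ (k : ℕ) (U : Site d → Fin d → (Matrix n n ℂ)ˣ),
      IsMinimiser d (ClassSix d L N ε₀) L N (k + 1) V U → RegularSup d L N b c (k + 1) U →
        rescale L (bavg L U) ∈ ClassSix (n := n) d L N ε₀ k)
    {X : Type*} (loc : ℕ → (Site d → Fin d → (Matrix n n ℂ)ˣ) → X → ℝ) :
    ActionRate (minActReadings d (ClassSix d L N ε₀) L N dom loc)
      (wallConstNA d L * (gradConst d 1 + 1) / (L : ℝ) ^ 2) (((L : ℝ) ^ 2)⁻¹) :=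
  actionRate_thm1Type_mem hd hL hN hb hc hbt hct (by linarith) hCle hT1 hT2 hT3 hB hC hmin h4
    (fun _ _ hU => mem_classSix_of_regularSup hL hB0 hB4 hBε hCε hU) loc

end

end Summit.QuantumFields.BalabanUV.T4Continuum.MinimalActionMemClass
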